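import Summits.AnomalousDissipation.AnomalousDissipation.Theses.WazewskiBlock
import Literature.Analysis.FluidPDE.LongTimeAverageSubadditive
import Literature.Analysis.FluidPDE.LerayHopfSpectralMeasurability
import Literature.Analysis.FluidPDE.LerayHopfGeneralizedEnergyIneq

/-!
# Route WazewskiBlock (AnomalousDissipation) — frame item `PointwiseFloorToSummit`

Settles stmt-AnomalousDissipation-1737:
`PointwiseFloorToSummit := PointwiseFloorFamily → AnomalousDissipation`.

`PointwiseFloorFamily` (the route's thesis X) provides a smooth divergence-free mean-zero steady
force `f`, viscosities `ν j > 0` with `ν j → 0`, global Leray–Hopf solutions `u j`, and constants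
`E`, `ε₀ > 0` with the POINTWISE-in-time bounds `kineticEnergy (u j t) ≤ E` and
`ε₀ ≤ (f, u j t) = ∫ ⟪f, u j t⟫` for all `t ≥ 0`, plus the no-leakage clause
`⟨(f, u j)⟩ ≤ meanDissipation (ν j) (u j)`. The zeroth law
(`AnomalousDissipation ≡ Literature.Turb.ZerothLaw`) asks for the same force and family with
bounded MEAN energies `meanEnergy (u j) ≤ E'` and mean dissipation rates bounded below,
`ε ≤ meanDissipation (ν j) (u j)`. The passage is elementary Cesàro bookkeeping
(Foias–Manley–Rosa–Temam 2001, Ch. II (12.38)–(12.39); Doering–Foias 2002, §2):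

* `meanEnergy (u j) = ⟨∫ ‖u j t‖²⟩ ≤ 2E`: the slice energy `∫ ‖u j t‖² = 2 · kineticEnergy (u j t)`
  is nonnegative for every `t` and at most `2E` for `t > 0`, so
  `Literature.Analysis.FluidPDE.longTimeAvgSup_le_const` applies (it already absorbs the junk
  value `0` of the running mean of a non-integrable slice functional).
* `ε₀ ≤ ⟨(f, u j)⟩`: the work pairing `t ↦ ∫ ⟪f, u j t⟫` is continuous on every `(0, T]` (weak
  `L²` continuity of Leray–Hopf solutions tested against `f ∈ L²`), bounded below by `ε₀ > 0`
  and above by `½ (‖f‖₂² + 2E)` (Young's inequality and the energy cap), hence integrable on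
  every `(0, T]`; so its running means lie in `[ε₀, ½ (‖f‖₂² + 2E)]` for every `T > 0` and
  `Filter.le_limsup_of_frequently_le` gives the floor. With the no-leakage clause,
  `ε₀ ≤ meanDissipation (ν j) (u j)`.
-/

noncomputable section

open MeasureTheory Set Filter Topology
open scoped InnerProductSpace RealInnerProductSpace

namespace Summit.AnomalousDissipation.AnomalousDissipation.Theorems

-- D-0017: single-problem summit ⇒ `Summit.AnomalousDissipation.AnomalousDissipation.…` by design.
set_option linter.dupNamespace false

open Literature.Analysis.FluidPDE Literature.Analysis.FunctionSpaces

/-- **Work bound under the energy cap.** For a steady force `f ∈ L²(T³)` and a global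
Leray–Hopf solution `u` forced by `f` with `kineticEnergy (u t) ≤ E` for `t ≥ 0`, the work
pairing obeys `∫ ⟪f, u t⟫ ≤ ½ (∫ ‖f‖² + 2E)` for every `t ≥ 0` (Young's inequality
`|(f, w)| ≤ ½ (‖f‖₂² + ‖w‖₂²)`, `Torus.abs_integral_inner_le_half`, and `‖u t‖₂² = 2 · KE ≤ 2E`;
every slice `u t`, `t ≥ 0`, is in `L²`, `Torus.IsGlobalLerayHopf.memLp_two`). -/
theorem pointwiseFloor_work_le {d : Type*} [Fintype d] [DecidableEq d] {ν E : ℝ}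
    {f u₀ : UnitAddTorus d → EuclideanSpace ℝ d} {u : ℝ → UnitAddTorus d → EuclideanSpace ℝ d}
    (hf : MemLp f 2 volume) (hu : Torus.IsGlobalLerayHopf ν (fun _ => f) u₀ u)
    (hE : ∀ t, 0 ≤ t → Torus.kineticEnergy (u t) ≤ E) {t : ℝ} (ht : 0 ≤ t) :
    ∫ x, ⟪f x, u t x⟫_ℝ ≤ 2⁻¹ * ((∫ x, ‖f x‖ ^ 2) + 2 * E) := by
  have h1 := (le_abs_self _).trans (Torus.abs_integral_inner_le_half hf (hu.memLp_two ht))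
  have h2 : ∫ x, ‖u t x‖ ^ 2 ≤ 2 * E := by
    have h := hE t ht
    unfold Torus.kineticEnergy at h
    linarith
  calc ∫ x, ⟪f x, u t x⟫_ℝ ≤ 2⁻¹ * ((∫ x, ‖f x‖ ^ 2) + ∫ x, ‖u t x‖ ^ 2) := h1
    _ ≤ 2⁻¹ * ((∫ x, ‖f x‖ ^ 2) + 2 * E) := by gcongr

/-- **Integrability of the work pairing on `(0, T]`.** For a steady force `f ∈ L²(T³)` and a
global Leray–Hopf solution `u` forced by `f`, the pairing `t ↦ ∫ ⟪f, u t⟫` is continuous on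
`(0, T]` (weak `L²` continuity of Leray–Hopf solutions, field `weak_continuous` with `w = f`,
and symmetry of the real inner product); if moreover `ε₀ ≤ ∫ ⟪f, u t⟫ ≤ C` for `t ≥ 0` with
`ε₀ > 0`, it is bounded in norm by `C` on `(0, T]`, hence integrable there (`(0, T]` has finite
measure; `MeasureTheory.Integrable.of_bound`). -/
theorem pointwiseFloor_integrableOn_work {d : Type*} [Fintype d] [DecidableEq d] {ν ε₀ C : ℝ}
    {f u₀ : UnitAddTorus d → EuclideanSpace ℝ d} {u : ℝ → UnitAddTorus d → EuclideanSpace ℝ d}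
    (hf : MemLp f 2 volume) (hu : Torus.IsGlobalLerayHopf ν (fun _ => f) u₀ u) (hε₀ : 0 < ε₀)
    (hlow : ∀ t, 0 ≤ t → ε₀ ≤ ∫ x, ⟪f x, u t x⟫_ℝ)
    (hup : ∀ t, 0 ≤ t → ∫ x, ⟪f x, u t x⟫_ℝ ≤ C) {T : ℝ} (hT : 0 < T) :
    IntegrableOn (fun t => ∫ x, ⟪f x, u t x⟫_ℝ) (Ioc 0 T) := by
  have hcont : ContinuousOn (fun t => ∫ x, ⟪f x, u t x⟫_ℝ) (Ioc 0 T) := by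
    have h := ((hu T hT).weak_continuous f hf).1
    refine h.congr fun t _ => ?_
    exact integral_congr_ae (ae_of_all _ fun x => real_inner_comm _ _)
  refine Integrable.of_bound (hcont.aestronglyMeasurable measurableSet_Ioc) C ?_
  filter_upwards [ae_restrict_mem measurableSet_Ioc] with t ht
  rw [Real.norm_eq_abs, abs_of_nonneg (hε₀.le.trans (hlow t ht.1.le))]
  exact hup t ht.1.le

/-- **Cesàro floor.** If `g` is integrable on every `(0, T]`, `T > 0`, with `ε₀ ≤ g t ≤ C` for all
`t ≥ 0`, then `ε₀ ≤ ⟨g⟩ = limsup_{T → ∞} T⁻¹ ∫₀ᵀ g`: the running means satisfy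
`ε₀ ≤ T⁻¹ ∫₀ᵀ g ≤ C` for every `T > 0` (monotonicity of the set integral on `(0, T]`, of
Lebesgue measure `T`), so they are eventually bounded above and frequently (indeed eventually)
`≥ ε₀`, and `Filter.le_limsup_of_frequently_le` applies (Foias–Manley–Rosa–Temam 2001,
Ch. II (12.38)–(12.39)). -/
theorem pointwiseFloor_le_longTimeAvgSup {g : ℝ → ℝ} {ε₀ C : ℝ}
    (hgi : ∀ T, 0 < T → IntegrableOn g (Ioc 0 T))
    (hlow : ∀ t, 0 ≤ t → ε₀ ≤ g t) (hup : ∀ t, 0 ≤ t → g t ≤ C) :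
    ε₀ ≤ longTimeAvgSup g := by
  have hmean_ge : ∀ T, 0 < T → ε₀ ≤ timeMean g T := fun T hT => by
    unfold timeMean
    rw [intervalIntegral.integral_of_le hT.le]
    have h1 : ∫ _ in Ioc 0 T, ε₀ ≤ ∫ t in Ioc 0 T, g t :=
      setIntegral_mono_on (integrableOn_const (hs := measure_Ioc_lt_top.ne)) (hgi T hT)
        measurableSet_Ioc fun t ht => hlow t ht.1.le
    rw [setIntegral_const, Real.volume_real_Ioc_of_le hT.le, sub_zero, smul_eq_mul] at h1
    calc ε₀ = T⁻¹ * (T * ε₀) := by rw [← mul_assoc, inv_mul_cancel₀ hT.ne', one_mul]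
      _ ≤ T⁻¹ * ∫ t in Ioc 0 T, g t := mul_le_mul_of_nonneg_left h1 (inv_nonneg.2 hT.le)
  have hmean_le : ∀ T, 0 < T → timeMean g T ≤ C := fun T hT => by
    unfold timeMean
    rw [intervalIntegral.integral_of_le hT.le]
    have h1 : ∫ t in Ioc 0 T, g t ≤ ∫ _ in Ioc 0 T, C :=
      setIntegral_mono_on (hgi T hT) (integrableOn_const (hs := measure_Ioc_lt_top.ne))
        measurableSet_Ioc fun t ht => hup t ht.1.le
    rw [setIntegral_const, Real.volume_real_Ioc_of_le hT.le, sub_zero, smul_eq_mul] at h1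
    calc T⁻¹ * ∫ t in Ioc 0 T, g t ≤ T⁻¹ * (T * C) :=
        mul_le_mul_of_nonneg_left h1 (inv_nonneg.2 hT.le)
      _ = C := by rw [← mul_assoc, inv_mul_cancel₀ hT.ne', one_mul]
  unfold longTimeAvgSup
  refine le_limsup_of_frequently_le ?_ ?_
  · exact ((eventually_gt_atTop (0 : ℝ)).mono hmean_ge).frequently
  · exact ⟨C, (eventually_gt_atTop (0 : ℝ)).mono hmean_le⟩

/-- Settles stmt-AnomalousDissipation-1737 (route `WazewskiBlock`, support / frame item #1):
the pointwise-floor thesis `PointwiseFloorFamily` implies `AnomalousDissipation`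
(`≡ Literature.Turb.ZerothLaw`). Proof: destructure the witness `(f, ν, u₀, u, E, ε₀)`; keep
`f`, `ν`, `u₀`, `u` and the three clauses on them verbatim; bound the mean energies by `2E`
(`longTimeAvgSup_le_const`: `∫ ‖u j t‖² = 2 · kineticEnergy (u j t) ≤ 2E` for `t > 0`,
nonnegative for all `t`); and bound the mean dissipation rates below by `ε₀` through the
no-leakage clause `⟨(f, u j)⟩ ≤ meanDissipation (ν j) (u j)` and the Cesàro floor
`ε₀ ≤ ⟨(f, u j)⟩` (`pointwiseFloor_le_longTimeAvgSup`, fed by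
`pointwiseFloor_integrableOn_work` and `pointwiseFloor_work_le`; `f ∈ L²` since it is smooth,
`Torus.IsSmooth.memLp`). -/
theorem pointwiseFloorToSummit_proof :
    Summit.AnomalousDissipation.AnomalousDissipation.Theses.WazewskiBlock.PointwiseFloorToSummit := by
  unfold Summit.AnomalousDissipation.AnomalousDissipation.Theses.WazewskiBlock.PointwiseFloorToSummit
    Summit.AnomalousDissipation.AnomalousDissipation.Theses.WazewskiBlock.PointwiseFloorFamily
    _root_.AnomalousDissipation Literature.Turb.ZerothLaw
  rintro ⟨f, hf, hdiv, hmean, ν, u₀, u, hν, hν0, hLH, E, ε₀, hε₀, hpt, hleak⟩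
  refine ⟨f, hf, hdiv, hmean, ν, u₀, u, hν, hν0, hLH, ⟨2 * E, fun j => ?_⟩, ε₀, hε₀, fun j => ?_⟩
  · -- bounded mean energy: `meanEnergy (u j) ≤ 2E`
    rw [meanEnergy_eq_longTimeAvgSup]
    refine longTimeAvgSup_le_const (fun t => integral_nonneg fun x => sq_nonneg _) fun t ht => ?_
    have h := (hpt j t ht.le).1
    unfold Torus.kineticEnergy at h
    show ∫ x, ‖u j t x‖ ^ 2 ≤ 2 * E
    linarith
  · -- dissipation floor: `ε₀ ≤ ⟨(f, u j)⟩ ≤ meanDissipation (ν j) (u j)`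
    have hf2 : MemLp f 2 volume := hf.memLp 2
    have hup : ∀ t, 0 ≤ t → ∫ x, ⟪f x, u j t x⟫_ℝ ≤ 2⁻¹ * ((∫ x, ‖f x‖ ^ 2) + 2 * E) :=
      fun t ht => pointwiseFloor_work_le hf2 (hLH j) (fun s hs => (hpt j s hs).1) ht
    have hlow : ∀ t, 0 ≤ t → ε₀ ≤ ∫ x, ⟪f x, u j t x⟫_ℝ := fun t ht => (hpt j t ht).2
    exact (pointwiseFloor_le_longTimeAvgSup
      (fun T hT => pointwiseFloor_integrableOn_work hf2 (hLH j) hε₀ hlow hup hT) hlow hup).trans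
      (hleak j)

end Summit.AnomalousDissipation.AnomalousDissipation.Theorems

end
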